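import Literature.NumberTheory.GaloisCohomology.TateGlobalEulerCharacteristic
import Literature.NumberTheory.GaloisCohomology.GlobalEulerPoincareCharacteristic
import HarnessLib

/-!
# Tate's global Euler–Poincaré characteristic formula — the two typings in the tree are equivalent

Topic `NumberTheory/GaloisCohomology`; namespace `Literature.NumberTheory.GaloisCohomology`.
THEOREMS ONLY (no definition, no named fact, no `sorry`, no instance).

Milne, *Arithmetic Duality Theorems* (2nd ed. 2006), I Thm. 5.1 (p. 67: "`χ(G_S, M) =
∏_{v arch} [H⁰(G_v, M)]/|[M]|_v`", footnote 13: "`|[M]|_v = [M]` if `v` is real, and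
`|[M]|_v = [M]²` if `v` is complex") was typed twice on 2026-08-28 (two width seats of the cell
`bsd-ssimc`, three minutes apart):

* `tateGlobalEulerPoincareCharacteristic K` (`TateGlobalEulerCharacteristic.lean`): archimedean side
  `∏_{w ∣ ∞} #M^{mult w}` and `H⁰(K_w, M) = galoisCohomology (ρ.toLocal (Sum.inl w)) 0`;
* `globalEulerPoincareCharacteristic K` (`GlobalEulerPoincareCharacteristic.lean`): archimedean
  side `#M^{[K : ℚ]}` and `H⁰(K_w, M) = (ρ.toLocal (Sum.inl w)).invariants`.

This file proves **`tateGlobalEulerPoincareCharacteristic_iff_globalEulerPoincareCharacteristic`**: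
the two `Prop`s are EQUIVALENT (`∑_{w ∣ ∞} mult w = [K : ℚ]`, Mathlib
`InfinitePlace.sum_mult_eq`; `H⁰(K_w, M) ≃+ M^{Γ_{K_w}}`, the tree's `galoisCohomologyZeroEquiv`),
so that every consumer of either name is served by the other and a librarian may deprecate one of
the two declarations without touching consumers.

## References
* [MilneADT2006] J. S. Milne, *Arithmetic Duality Theorems*, 2nd ed. (2006), Ch. I §5, Thm. 5.1
  (p. 67) with footnote 13.
-/

noncomputable section

open Function NumberField Field IsDedekindDomain
open scoped NumberField

namespace Literature.NumberTheory.GaloisCohomology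

open Literature.NumberTheory.GaloisRepresentations
open Literature.NumberTheory.GaloisRepresentations.DiscreteGaloisModule (restrictedCohomology toLocal)

variable {K : Type} [Field K] [NumberField K]

section Archimedean

variable {M : Type} [AddCommGroup M] [TopologicalSpace M] [DiscreteTopology M]

omit [NumberField K] [AddCommGroup M] [TopologicalSpace M] [DiscreteTopology M] in
/-- `∏_{w ∣ ∞} #M^{mult w} = #M^{[K : ℚ]}` (`∑_w mult w = [K : ℚ]`). [cite: MilneADT2006, Ch. I §5, footnote 13 (p. 67)] -/
theorem prod_natCard_pow_mult_eq_pow_finrank [NumberField K] :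
    ∏ w : InfinitePlace K, Nat.card M ^ w.mult = Nat.card M ^ Module.finrank ℚ K := by
  rw [Finset.prod_pow_eq_pow_sum, InfinitePlace.sum_mult_eq]

/-- `#H⁰(K_w, M) = #M^{Γ_{K_w}}` (degree-zero Galois cohomology is the invariants).
[cite: MilneADT2006, Ch. I §5, footnote 13 (p. 67)] -/
theorem natCard_galoisCohomology_zero_toLocal_inl_eq_natCard_invariants (ρ : DiscreteGaloisModule K M)
    (w : InfinitePlace K) :
    Nat.card (galoisCohomology (ρ.toLocal (Sum.inl w)) 0) =
      Nat.card ((ρ.toLocal (Sum.inl w)).invariants) :=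
  Nat.card_congr (galoisCohomologyZeroEquiv (ρ.toLocal (Sum.inl w))).toEquiv

end Archimedean

/-- **The two typings of Milne I Thm. 5.1 in the tree are equivalent.**
[cite: MilneADT2006, Ch. I §5, Thm. 5.1 (p. 67) with footnote 13] -/
theorem tateGlobalEulerPoincareCharacteristic_iff_globalEulerPoincareCharacteristic :
    tateGlobalEulerPoincareCharacteristic K ↔ globalEulerPoincareCharacteristic K := by
  refine ⟨fun h S hS M _ _ _ _ ρ hur hcard => ?_, fun h S hS M _ _ _ _ ρ hur hcard => ?_⟩
  · have hT := h S hS M ρ hur hcard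
    rw [prod_natCard_pow_mult_eq_pow_finrank, Finset.prod_congr rfl fun w _ =>
      natCard_galoisCohomology_zero_toLocal_inl_eq_natCard_invariants ρ w] at hT
    exact hT
  · have hG := h S hS M ρ hur hcard
    rw [prod_natCard_pow_mult_eq_pow_finrank, Finset.prod_congr rfl fun w _ =>
      natCard_galoisCohomology_zero_toLocal_inl_eq_natCard_invariants ρ w]
    exact hG

/-- From `globalEulerPoincareCharacteristic` to `tateGlobalEulerPoincareCharacteristic`.
[cite: MilneADT2006, Ch. I §5, Thm. 5.1 (p. 67)] -/
theorem tateGlobalEulerPoincareCharacteristic_of_globalEulerPoincareCharacteristic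
    (h : globalEulerPoincareCharacteristic K) : tateGlobalEulerPoincareCharacteristic K :=
  tateGlobalEulerPoincareCharacteristic_iff_globalEulerPoincareCharacteristic.mpr h

/-- From `tateGlobalEulerPoincareCharacteristic` to `globalEulerPoincareCharacteristic`.
[cite: MilneADT2006, Ch. I §5, Thm. 5.1 (p. 67)] -/
theorem globalEulerPoincareCharacteristic_of_tateGlobalEulerPoincareCharacteristic
    (h : tateGlobalEulerPoincareCharacteristic K) : globalEulerPoincareCharacteristic K :=
  tateGlobalEulerPoincareCharacteristic_iff_globalEulerPoincareCharacteristic.mp h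

end Literature.NumberTheory.GaloisCohomology

end
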